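import Summits.AnomalousDissipation.AnomalousDissipation.Theses.NeutralTaylorWaves
import Literature.Analysis.FluidPDE.SteadyNSLatticePersistence

/-!
# Abstract bordered Fredholm alternative on `E × ℝ`
# (line `Sketch`, crux `NeutralTaylorWaves.NewtonRealisation`, stmt-AnomalousDissipation-16315)

Sorry-free discharge of the registered stub `stub_borderedFredholm` of the skeleton of
`Summit.AnomalousDissipation.AnomalousDissipation.Theses.NeutralTaylorWaves.NewtonRealisation`.

On a real Banach space `E`, let `K : E →L[ℝ] E` be compact, `c ≠ 0`, `e ∈ E` and `φ : E →L[ℝ] ℝ`.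
The BORDERED operator `(x, t) ↦ (c•x + K x − t•e, φ x)` on `E × ℝ` is `c·1 + 𝒦` with
`𝒦 (x, t) = (K x − t•e, φ x − c t)` compact (`K ∘ fst` is compact, and the two remaining pieces
factor through the locally compact space `ℝ`), so the packaged Fredholm alternative
`Literature.Analysis.FluidPDE.SteadyLattice.exists_equiv_of_injective` (Mathlib's
`IsCompactOperator.hasEigenvalue_or_mem_resolventSet` + the open mapping theorem) turns the
trivial-kernel hypothesis into a linear homeomorphism of `E × ℝ`.

References: S.-N. Chow, J. K. Hale, *Methods of Bifurcation Theory* (1982), §2.4 (bordered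
operators); T. Kato, *Perturbation Theory for Linear Operators* (1966), Ch. IV §5 (Fredholm
alternative for compact perturbations).
-/

set_option linter.dupNamespace false

noncomputable section

open Filter Set Topology

namespace Summit.AnomalousDissipation.AnomalousDissipation.Theorems.NewtonRealisation.BorderedFredholm

/-- **The compact part of the bordered operator.** For `K : E →L[ℝ] E` compact, `e : E`,
`φ : E →L[ℝ] ℝ` and `c : ℝ`, the operator `(x, t) ↦ (K x − t•e, φ x − c t)` on `E × ℝ`, written as
`inl ∘ K ∘ fst − (t ↦ t•(e, c)) ∘ snd + inr ∘ φ ∘ fst`, is compact: the first summand is a compact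
operator composed with bounded ones, the other two factor through the locally compact space `ℝ`.
[folklore] -/
theorem isCompactOperator_borderPart {E : Type*} [NormedAddCommGroup E] [NormedSpace ℝ E]
    {K : E →L[ℝ] E} (hK : IsCompactOperator K) (c : ℝ) (e : E) (φ : E →L[ℝ] ℝ) :
    IsCompactOperator
      ((ContinuousLinearMap.inl ℝ E ℝ).comp (K.comp (ContinuousLinearMap.fst ℝ E ℝ)) -
          (ContinuousLinearMap.toSpanSingleton ℝ ((e, c) : E × ℝ)).comp
            (ContinuousLinearMap.snd ℝ E ℝ) +
        (ContinuousLinearMap.inr ℝ E ℝ).comp (φ.comp (ContinuousLinearMap.fst ℝ E ℝ)) :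
        E × ℝ →L[ℝ] E × ℝ) := by
  have h1 : IsCompactOperator
      ((ContinuousLinearMap.inl ℝ E ℝ).comp (K.comp (ContinuousLinearMap.fst ℝ E ℝ))) :=
    (hK.comp_clm (ContinuousLinearMap.fst ℝ E ℝ)).clm_comp (ContinuousLinearMap.inl ℝ E ℝ)
  have h2 : IsCompactOperator
      ((ContinuousLinearMap.toSpanSingleton ℝ ((e, c) : E × ℝ)).comp
        (ContinuousLinearMap.snd ℝ E ℝ)) :=
    (isCompactOperator_of_locallyCompactSpace_rng
      (ContinuousLinearMap.toSpanSingleton ℝ ((e, c) : E × ℝ))).comp_clm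
        (ContinuousLinearMap.snd ℝ E ℝ)
  have h3 : IsCompactOperator
      ((ContinuousLinearMap.inr ℝ E ℝ).comp (φ.comp (ContinuousLinearMap.fst ℝ E ℝ))) :=
    (isCompactOperator_of_locallyCompactSpace_dom
      (φ.comp (ContinuousLinearMap.fst ℝ E ℝ))).clm_comp (ContinuousLinearMap.inr ℝ E ℝ)
  exact (h1.sub h2).add h3

/-- **Abstract bordered Fredholm alternative** (registered stub `stub_borderedFredholm`). On a real
Banach space `E`, for `K` compact, `c ≠ 0`, `e : E`, `φ : E →L[ℝ] ℝ`: if the bordered operator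
`(x, t) ↦ (c•x + K x − t•e, φ x)` on `E × ℝ` has trivial kernel, it is a linear homeomorphism of
`E × ℝ` (it is `c·1 + compact`, so the Fredholm alternative
`SteadyLattice.exists_equiv_of_injective` applies on the Banach space `E × ℝ`). [folklore] -/
theorem stub_borderedFredholm :
    ∀ {E : Type} [NormedAddCommGroup E] [NormedSpace ℝ E] [CompleteSpace E]
      (K : E →L[ℝ] E), IsCompactOperator K → ∀ (c : ℝ), c ≠ 0 → ∀ (e : E) (φ : E →L[ℝ] ℝ),
      (∀ (x : E) (t : ℝ), c • x + K x - t • e = 0 → φ x = 0 → x = 0 ∧ t = 0) →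
      ∃ L : (E × ℝ) ≃L[ℝ] (E × ℝ), ∀ (x : E) (t : ℝ), L (x, t) = (c • x + K x - t • e, φ x) := by
  intro E _ _ _ K hK c hc e φ hinj
  -- the compact part `𝒦 (x, t) = (K x − t•e, φ x − c t)` of the bordered operator `c·1 + 𝒦`
  set 𝒦 : E × ℝ →L[ℝ] E × ℝ :=
    (ContinuousLinearMap.inl ℝ E ℝ).comp (K.comp (ContinuousLinearMap.fst ℝ E ℝ)) -
        (ContinuousLinearMap.toSpanSingleton ℝ ((e, c) : E × ℝ)).comp
          (ContinuousLinearMap.snd ℝ E ℝ) +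
      (ContinuousLinearMap.inr ℝ E ℝ).comp (φ.comp (ContinuousLinearMap.fst ℝ E ℝ)) with h𝒦
  have h𝒦x : ∀ (x : E) (t : ℝ), 𝒦 (x, t) = (K x - t • e, φ x - c * t) := by
    intro x t
    refine Prod.ext ?_ ?_
    · simp [h𝒦, ContinuousLinearMap.toSpanSingleton_apply]
    · simp [h𝒦, ContinuousLinearMap.toSpanSingleton_apply]
      ring
  have h𝒦c : IsCompactOperator 𝒦 := isCompactOperator_borderPart hK c e φ
  -- trivial kernel of `c·1 + 𝒦`
  have hinj' : ∀ p : E × ℝ, c • p + 𝒦 p = 0 → p = 0 := by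
    rintro ⟨x, t⟩ h
    rw [h𝒦x, Prod.smul_mk, Prod.mk_add_mk, Prod.mk_eq_zero, smul_eq_mul] at h
    obtain ⟨h1, h2⟩ := h
    have hx : c • x + K x - t • e = 0 := by rwa [← add_sub_assoc] at h1
    have ht : φ x = 0 := by linear_combination h2
    obtain ⟨rfl, rfl⟩ := hinj x t hx ht
    rfl
  -- the packaged Fredholm alternative on the Banach space `E × ℝ`
  obtain ⟨L, hL⟩ :=
    Literature.Analysis.FluidPDE.SteadyLattice.exists_equiv_of_injective h𝒦c hc hinj'
  refine ⟨L, fun x t => ?_⟩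
  rw [hL, h𝒦x, Prod.smul_mk, Prod.mk_add_mk, smul_eq_mul, Prod.mk.injEq]
  exact ⟨(add_sub_assoc _ _ _).symm, by ring⟩

end Summit.AnomalousDissipation.AnomalousDissipation.Theorems.NewtonRealisation.BorderedFredholm

end
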